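import Mathlib.Algebra.BigOperators.Expect
import Mathlib.Algebra.Order.BigOperators.Expect
import Mathlib.Logic.Function.DependsOn
import Mathlib.Data.Real.Basic
import Mathlib.Data.ZMod.Basic
import Literature.NumberTheory.Sieve.LinearEquationsInPrimesGowersCauchySchwarz
import HarnessLib

/-!
# Conlon–Fox–Zhao: cut norms, the dense model theorem and the relative counting lemma (statements)

Topic `Literature/Combinatorics/Additive`. Source: D. Conlon, J. Fox, Y. Zhao, *The Green–Tao
theorem: an exposition*, EMS Surv. Math. Sci. 1 (2014), 249–282 = arXiv:1403.2957 (held as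
`paper:arxiv-1403.2957`; numbers are those of the arXiv version), §5 (dense model theorem) and
§6 (counting lemma). This file is the first layer of the decomposition of the named fact
`Literature.Combinatorics.Additive.CFZ.RelativeSzemeredi` (Thm. 4.3, file `RelativeSzemeredi.lean`) along its printed proof
(§7): it vendors the two intermediate results of the source as named facts,

* `CFZ.DenseModel` — Theorem 5.1 (the dense model theorem, in Zhao's cut-norm form);
* `CFZ.RelativeCounting` — Theorem 6.5 (the relative simplex counting lemma),

together with the real definitions they need:

* `CFZ.IsCutFamily e a`, `CFZ.cutAverage e G a`, `CFZ.HasSmallCut e G ε` — the hypergraph cut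
  norm (5.2) of a weighted `r`-uniform `r`-partite hypergraph, rendered as the predicate
  "`‖G‖_□ ≤ ε`": for every family of sets `A_l ⊆ X_{-l}`, `l ∈ e` (here: `{0,1}`-valued
  functions `a l` of the full point `x : ι → X` depending only on the coordinates `e ∖ {l}`),
  `|𝔼_x G(x) ∏_{l ∈ e} 1_{A_l}(x_{-l})| ≤ ε`. Points are `x : ι → X` for ONE vertex type `X`
  and the edge is supported on a finite set `e` of coordinates (the others are dummy variables,
  averaged over but read by nothing) — the convention of the tree's Gowers–Cauchy–Schwarz file
  (`Literature.NumberTheory.Sieve.mixPt`, `Literature.NumberTheory.Sieve.boxPower`), which the proofs use; the cut norm `‖f‖_{□,r}` of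
  `f : ℤ_N → ℝ` (5.3) is the case `X = ℤ_N`, `G(x) = f(∑_{i ∈ e} x_i)`, `|e| = r`;
* `CFZ.LFCWithin ν δ` — the `k`-linear forms condition for a weighted hypergraph
  (§6, display before Thm. 6.5) in quantitative form: every sub-product of the `k 2^{k-1}`
  factors `ν_{-j}(x^{(ω)}_{-j})`, `ω ∈ {0,1}^{[k] ∖ {j}}`, has average within `δ` of `1`.

API: monotonicity in `ε`, the trivial family, the transport of `HasSmallCut` along a
relabelling of coordinates combined with coordinatewise bijections
(`CFZ.hasSmallCut_map_iff`) — the change of variables behind (7.1)–(7.2) of the source —, shears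
of `G^ι` (`CFZ.shear`) and the equidistribution of `∑_{i ∈ e} x_i` (`CFZ.expect_comp_sum_eq`,
whence `‖F‖_{□,r} ≤ ε ⇒ |𝔼 F| ≤ ε`, the instance of `‖·‖ ≤ ‖·‖₁` used in §§5, 7).

## Rendering of the asymptotic notation

The source states Thm. 6.5 with `o(1)`'s for sequences of hypergraphs indexed by an implicit
parameter `N → ∞` (the vertex sets being arbitrary finite sets depending on `N`). We state it in
the `ε`–`δ` form its proof gives ("for every `ε > 0` there is `δ = δ(k, ε) > 0` …"), which is
equivalent to the printed sequential form by running the latter on a sequence of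
counterexamples; Thm. 5.1 is already printed in `ε`–`ε'` form. All parts `X_1 = ⋯ = X_k = X` are
taken equal (the case of the application in §7, `X_i = ℤ_N`); the printed statement allows
distinct finite parts, so what is vendored is a special case of it.

## References
* D. Conlon, J. Fox, Y. Zhao, *The Green–Tao theorem: an exposition*, EMS Surv. Math. Sci. 1
  (2014), 249–282, §5 ((5.2), (5.3), Thm. 5.1), §6 (Thm. 6.5), §7. [cite: ConlonFoxZhao2014]
* D. Conlon, J. Fox, Y. Zhao, *A relative Szemerédi theorem*, Geom. Funct. Anal. 25 (2015),
  733–762 (full proof of Thm. 6.5).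
* Y. Zhao, *An arithmetic transference proof of a relative Szemerédi theorem*, Math. Proc.
  Cambridge Philos. Soc. 156 (2014), 255–261 (Thm. 5.1 in this form).
-/

noncomputable section

open Finset
open scoped BigOperators

namespace Literature.Combinatorics.Additive.CFZ

/-! ### Cut norms (5.2)–(5.3) -/

section cut

variable {ι : Type*} [DecidableEq ι] {X : Type*}

/-- A family of *cut decorations* on the coordinates `e`: for each `l`, `a l` is the indicator
function of a set of points, and for `l ∈ e` this set depends only on the coordinates in
`e ∖ {l}` — i.e. it is a set `A_l ⊆ X_{-l} = ∏_{j ∈ e, j ≠ l} X_j` as in (5.2) (read off the full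
point). [cite: ConlonFoxZhao2014, Section 5, (5.2)] -/
structure IsCutFamily (e : Finset ι) (a : ι → (ι → X) → ℝ) : Prop where
  zero_or_one : ∀ l x, a l x = 0 ∨ a l x = 1
  dependsOn : ∀ l ∈ e, DependsOn (a l) (↑(e.erase l) : Set ι)

variable [Fintype ι] [Fintype X]

/-- The decorated average `𝔼_x G(x) ∏_{l ∈ e} 1_{A_l}(x_{-l})` whose supremum over cut families is
the cut norm (5.2) of the weighted `|e|`-uniform hypergraph `G` on the coordinates `e`.
[cite: ConlonFoxZhao2014, Section 5, (5.2)] -/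
def cutAverage (e : Finset ι) (G : (ι → X) → ℝ) (a : ι → (ι → X) → ℝ) : ℝ :=
  𝔼 x, G x * ∏ l ∈ e, a l x

/-- **The cut norm bound `‖G‖_□ ≤ ε`** (5.2): every decorated average of `G` over a cut family on
`e` is at most `ε` in absolute value. For `X = ℤ_N` and `G(x) = f(∑_{i ∈ e} x_i)` this is
`‖f‖_{□,r} ≤ ε`, `r = |e|` (5.3). [cite: ConlonFoxZhao2014, Section 5, (5.2)–(5.3)] -/
def HasSmallCut (e : Finset ι) (G : (ι → X) → ℝ) (ε : ℝ) : Prop :=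
  ∀ a : ι → (ι → X) → ℝ, IsCutFamily e a → |cutAverage e G a| ≤ ε

omit [Fintype ι] [Fintype X] in
/-- The trivial cut family (all sets everything). [folklore] -/
theorem isCutFamily_one (e : Finset ι) : IsCutFamily e (fun (_ : ι) (_ : ι → X) => (1 : ℝ)) :=
  ⟨fun _ _ => Or.inr rfl, fun _ _ _ _ _ => rfl⟩

omit [Fintype ι] [Fintype X] in
/-- Values of a cut decoration lie in `[0, 1]`. [folklore] -/
theorem IsCutFamily.nonneg_le_one {e : Finset ι} {a : ι → (ι → X) → ℝ} (ha : IsCutFamily e a)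
    (l : ι) (x : ι → X) : 0 ≤ a l x ∧ a l x ≤ 1 := by
  rcases ha.zero_or_one l x with h | h <;> simp [h]

/-- With the trivial family the decorated average is the plain average. [folklore] -/
theorem cutAverage_one (e : Finset ι) (G : (ι → X) → ℝ) :
    cutAverage e G (fun _ _ => 1) = 𝔼 x, G x := by
  simp [cutAverage]

/-- `‖G‖_□ ≤ ε` bounds the plain average: `|𝔼 G| ≤ ε`. [folklore] -/
theorem HasSmallCut.abs_expect_le {e : Finset ι} {G : (ι → X) → ℝ} {ε : ℝ}
    (h : HasSmallCut e G ε) : |𝔼 x, G x| ≤ ε := by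
  simpa [cutAverage_one] using h _ (isCutFamily_one e)

/-- Monotonicity of `‖G‖_□ ≤ ε` in `ε`. [folklore] -/
theorem HasSmallCut.mono {e : Finset ι} {G : (ι → X) → ℝ} {ε ε' : ℝ} (h : HasSmallCut e G ε)
    (hε : ε ≤ ε') : HasSmallCut e G ε' :=
  fun a ha => (h a ha).trans hε

/-- `‖-G‖_□ ≤ ε ↔ ‖G‖_□ ≤ ε`. [folklore] -/
theorem HasSmallCut.neg {e : Finset ι} {G : (ι → X) → ℝ} {ε : ℝ} (h : HasSmallCut e G ε) :
    HasSmallCut e (fun x => -G x) ε := by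
  intro a ha
  have : cutAverage e (fun x => -G x) a = -cutAverage e G a := by
    simp only [cutAverage, neg_mul, expect_neg_distrib]
  rw [this, abs_neg]
  exact h a ha

/-- `‖G‖_□ ≤ ε` forces `0 ≤ ε` (when there are points). [folklore] -/
theorem HasSmallCut.nonneg {e : Finset ι} {G : (ι → X) → ℝ} {ε : ℝ} (h : HasSmallCut e G ε) :
    0 ≤ ε :=
  (abs_nonneg _).trans (h _ (isCutFamily_one e))


/-- Linearity of the decorated average: sums. [folklore] -/
theorem cutAverage_add (e : Finset ι) (F G : (ι → X) → ℝ) (a : ι → (ι → X) → ℝ) :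
    cutAverage e (fun x => F x + G x) a = cutAverage e F a + cutAverage e G a := by
  simp only [cutAverage, add_mul, expect_add_distrib]

/-- Linearity of the decorated average: scalars. [folklore] -/
theorem cutAverage_const_mul (e : Finset ι) (c : ℝ) (F : (ι → X) → ℝ) (a : ι → (ι → X) → ℝ) :
    cutAverage e (fun x => c * F x) a = c * cutAverage e F a := by
  simp only [cutAverage, mul_assoc, mul_expect]

/-- Linearity of the decorated average: differences. [folklore] -/
theorem cutAverage_sub (e : Finset ι) (F G : (ι → X) → ℝ) (a : ι → (ι → X) → ℝ) :
    cutAverage e (fun x => F x - G x) a = cutAverage e F a - cutAverage e G a := by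
  simp only [cutAverage, sub_mul, expect_sub_distrib]

/-- `‖·‖_□ ≤ ‖·‖₁` ("`‖f‖ = sup_φ |⟨f,φ⟩| ≤ 𝔼|f(x)| = ‖f‖₁`", §5): a decorated average is at most
the average of `|F|`. [cite: ConlonFoxZhao2014, Section 5] -/
theorem abs_cutAverage_le_expect_abs {e : Finset ι} (F : (ι → X) → ℝ) {a : ι → (ι → X) → ℝ}
    (ha : IsCutFamily e a) : |cutAverage e F a| ≤ 𝔼 x, |F x| := by
  refine (abs_expect_le _ _).trans (expect_le_expect fun x _ => ?_)
  rw [abs_mul]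
  refine mul_le_of_le_one_right (abs_nonneg _) ?_
  rw [abs_of_nonneg (prod_nonneg fun l _ => (ha.nonneg_le_one l x).1)]
  exact prod_le_one (fun l _ => (ha.nonneg_le_one l x).1) fun l _ => (ha.nonneg_le_one l x).2

/-- A pointwise bound `|F| ≤ t` gives `‖F‖_□ ≤ t` (`‖·‖_□ ≤ ‖·‖₁ ≤ ‖·‖_∞`). [folklore] -/
theorem hasSmallCut_of_abs_le [Nonempty X] {e : Finset ι} {F : (ι → X) → ℝ} {t : ℝ}
    (hF : ∀ x, |F x| ≤ t) : HasSmallCut e F t := fun _ ha =>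
  (abs_cutAverage_le_expect_abs F ha).trans
    ((expect_le_expect fun x _ => hF x).trans (expect_const univ_nonempty t).le)

/-- The triangle inequality for `‖·‖_□ ≤ ·`. [folklore] -/
theorem HasSmallCut.add {e : Finset ι} {F G : (ι → X) → ℝ} {s t : ℝ} (hF : HasSmallCut e F s)
    (hG : HasSmallCut e G t) : HasSmallCut e (fun x => F x + G x) (s + t) := fun a ha => by
  rw [cutAverage_add]
  exact (abs_add_le _ _).trans (add_le_add (hF a ha) (hG a ha))

/-- `‖·‖_□ ≤ ·` for differences. [folklore] -/
theorem HasSmallCut.sub {e : Finset ι} {F G : (ι → X) → ℝ} {s t : ℝ} (hF : HasSmallCut e F s)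
    (hG : HasSmallCut e G t) : HasSmallCut e (fun x => F x - G x) (s + t) := fun a ha => by
  rw [cutAverage_sub]
  exact (abs_sub _ _).trans (add_le_add (hF a ha) (hG a ha))

/-- Homogeneity of `‖·‖_□ ≤ ·`. [folklore] -/
theorem HasSmallCut.const_mul {e : Finset ι} {F : (ι → X) → ℝ} {t : ℝ} (hF : HasSmallCut e F t)
    (c : ℝ) : HasSmallCut e (fun x => c * F x) (|c| * t) := fun a ha => by
  rw [cutAverage_const_mul, abs_mul]
  exact mul_le_mul_of_nonneg_left (hF a ha) (abs_nonneg c)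

end cut

/-! ### Transport of cut norms along relabellings and coordinatewise bijections -/

section transport

variable {ι ι' : Type*} {X X' : Type*}

/-- The map of points induced by a relabelling `τ : ι ≃ ι'` of the coordinates and bijections
`φ i : X ≃ X'` of the individual coordinates: `(Φ x)_{τ i} = φ_i(x_i)`. [folklore] -/
def pointMap (τ : ι ≃ ι') (φ : ι → X ≃ X') : (ι → X) ≃ (ι' → X') where
  toFun x i' := φ (τ.symm i') (x (τ.symm i'))
  invFun y i := (φ i).symm (y (τ i))
  left_inv x := by
    funext i
    simp only [Equiv.symm_apply_apply]
  right_inv y := by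
    funext i'
    simp only [Equiv.apply_symm_apply]

/-- `(Φ x)_{τ i} = φ_i(x_i)`. [folklore] -/
@[simp] theorem pointMap_apply (τ : ι ≃ ι') (φ : ι → X ≃ X') (x : ι → X) (i : ι) :
    pointMap τ φ x (τ i) = φ i (x i) := by
  simp [pointMap]

/-- `(Φ⁻¹ y)_i = φ_i⁻¹(y_{τ i})`. [folklore] -/
theorem pointMap_symm_apply (τ : ι ≃ ι') (φ : ι → X ≃ X') (y : ι' → X') (i : ι) :
    (pointMap τ φ).symm y i = (φ i).symm (y (τ i)) := rfl

variable [DecidableEq ι] [DecidableEq ι']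

/-- Pulling a cut family on `e.map τ` back along `pointMap τ φ` gives a cut family on `e`.
[folklore] -/
theorem IsCutFamily.comap {τ : ι ≃ ι'} {φ : ι → X ≃ X'} {e : Finset ι}
    {b : ι' → (ι' → X') → ℝ} (hb : IsCutFamily (e.map τ.toEmbedding) b) :
    IsCutFamily e (fun l x => b (τ l) (pointMap τ φ x)) := by
  refine ⟨fun l x => hb.zero_or_one _ _, fun l hl x y hxy => ?_⟩
  refine hb.dependsOn (τ l) (Finset.mem_map_of_mem _ hl) fun i' hi' => ?_
  obtain ⟨i, hi, rfl⟩ : ∃ i ∈ e.erase l, τ i = i' := by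
    have h1 : i' ∈ (e.map τ.toEmbedding).erase (τ l) := hi'
    rw [Finset.mem_erase, Finset.mem_map] at h1
    obtain ⟨hne, i, hi, rfl⟩ := h1
    exact ⟨i, Finset.mem_erase.mpr ⟨fun h => hne (by rw [h]; rfl), hi⟩, rfl⟩
  simp only [pointMap_apply, hxy i (by exact_mod_cast hi)]

/-- Pushing a cut family on `e` forward along `pointMap τ φ` gives a cut family on `e.map τ`.
[folklore] -/
theorem IsCutFamily.map {τ : ι ≃ ι'} {φ : ι → X ≃ X'} {e : Finset ι}
    {a : ι → (ι → X) → ℝ} (ha : IsCutFamily e a) :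
    IsCutFamily (e.map τ.toEmbedding) (fun l' y => a (τ.symm l') ((pointMap τ φ).symm y)) := by
  refine ⟨fun l x => ha.zero_or_one _ _, fun l' hl' x y hxy => ?_⟩
  have hl : τ.symm l' ∈ e := by simpa using hl'
  refine ha.dependsOn (τ.symm l') hl fun i hi => ?_
  have hi' : τ i ∈ (e.map τ.toEmbedding).erase l' := by
    rw [Finset.mem_coe, Finset.mem_erase] at hi
    rw [Finset.mem_erase]
    refine ⟨fun h => hi.1 (by rw [← h, Equiv.symm_apply_apply]), ?_⟩
    exact Finset.mem_map_of_mem τ.toEmbedding hi.2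
  have := hxy (τ i) (by exact_mod_cast hi')
  rw [pointMap_symm_apply, pointMap_symm_apply, this]

variable [Fintype ι] [Fintype ι'] [Fintype X] [Fintype X']

/-- Change of variables in a decorated average. [folklore] -/
theorem cutAverage_comp_pointMap (τ : ι ≃ ι') (φ : ι → X ≃ X') (e : Finset ι)
    (G : (ι' → X') → ℝ) (b : ι' → (ι' → X') → ℝ) :
    cutAverage e (fun x => G (pointMap τ φ x)) (fun l x => b (τ l) (pointMap τ φ x)) =
      cutAverage (e.map τ.toEmbedding) G b := by
  unfold cutAverage
  rw [← Fintype.expect_equiv (pointMap τ φ) _ (fun y => G y * ∏ l ∈ e.map τ.toEmbedding, b l y)]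
  intro x
  rw [Finset.prod_map]
  rfl

/-- **Transport of the cut norm.** For a relabelling `τ` of the coordinates and coordinatewise
bijections `φ_i`, `‖G‖_{□(e.map τ)} ≤ ε ↔ ‖G ∘ Φ‖_{□(e)} ≤ ε`, `Φ = pointMap τ φ`. This is the
change of variables giving (7.1)–(7.2) of the source (`τ = id`, `φ_i = ` multiplication by the
unit `j - i` of `ℤ_N`) and the independence of `‖·‖_{□,r}` of the labelling of the variables.
[cite: ConlonFoxZhao2014, Section 7, (7.1)–(7.2)] -/
theorem hasSmallCut_map_iff (τ : ι ≃ ι') (φ : ι → X ≃ X') (e : Finset ι) (G : (ι' → X') → ℝ)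
    (ε : ℝ) :
    HasSmallCut (e.map τ.toEmbedding) G ε ↔ HasSmallCut e (fun x => G (pointMap τ φ x)) ε := by
  constructor
  · intro h a ha
    have key := cutAverage_comp_pointMap τ φ e G
      (fun l' y => a (τ.symm l') ((pointMap τ φ).symm y))
    simp only [Equiv.symm_apply_apply] at key
    rw [key]
    exact h _ ha.map
  · intro h b hb
    rw [← cutAverage_comp_pointMap τ φ e G b]
    exact h _ hb.comap

end transport


/-! ### Shears of `G^ι`; averages of `F(∑_{i ∈ e} x_i)` -/

section shear

variable {ι : Type*} [DecidableEq ι] {G : Type*} [AddCommGroup G]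

/-- The shear `x ↦ (x with x_α := x_α - S(x))` for a function `S` not depending on the
coordinate `α`; a bijection of `G^ι`. [folklore] -/
def shear (α : ι) (S : (ι → G) → G) (hS : ∀ x u, S (Function.update x α u) = S x) :
    (ι → G) ≃ (ι → G) where
  toFun x := Function.update x α (x α - S x)
  invFun x := Function.update x α (x α + S x)
  left_inv x := by
    simp only [Function.update_idem, Function.update_self, hS, sub_add_cancel,
      Function.update_eq_self]
  right_inv x := by
    simp only [Function.update_idem, Function.update_self, hS, add_sub_cancel_right,
      Function.update_eq_self]

/-- The formula for a shear. [folklore] -/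
theorem shear_apply (α : ι) (S : (ι → G) → G) (hS : ∀ x u, S (Function.update x α u) = S x)
    (x : ι → G) : shear α S hS x = Function.update x α (x α - S x) := rfl

variable [Fintype ι] [Fintype G]

/-- Averages of `F(∑_{i ∈ e} x_i)` over `x ∈ G^ι`, `e ≠ ∅`, are plain averages of `F` over the
finite abelian group `G` (a shear makes the sum a coordinate). [folklore] -/
theorem expect_comp_sum_eq {e : Finset ι} (he : e.Nonempty) (F : G → ℝ) :
    (𝔼 x : ι → G, F (∑ i ∈ e, x i)) = 𝔼 z : G, F z := by
  obtain ⟨i₀, hi₀⟩ := he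
  haveI : Nonempty G := ⟨0⟩
  let S : (ι → G) → G := fun x => ∑ i ∈ e.erase i₀, x i
  have hS : ∀ x u, S (Function.update x i₀ u) = S x := fun x u =>
    Finset.sum_congr rfl fun i hi => Function.update_of_ne (Finset.ne_of_mem_erase hi) _ _
  rw [← Literature.NumberTheory.Sieve.expect_comp_equiv (shear i₀ S hS) (fun x => F (∑ i ∈ e, x i))]
  have h1 : ∀ x : ι → G, (∑ i ∈ e, shear i₀ S hS x i) = x i₀ := by
    intro x
    rw [← Finset.add_sum_erase _ _ hi₀, shear_apply, Function.update_self]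
    have : ∑ i ∈ e.erase i₀, Function.update x i₀ (x i₀ - S x) i = S x :=
      Finset.sum_congr rfl fun i hi => Function.update_of_ne (Finset.ne_of_mem_erase hi) _ _
    rw [this, sub_add_cancel]
  simp_rw [h1]
  rw [← Literature.NumberTheory.Sieve.expect_expect_update i₀ (fun x : ι → G => F (x i₀))]
  simp only [Function.update_self]
  exact Finset.expect_const Finset.univ_nonempty _

/-- `‖·‖_{□,r} ≤ ‖·‖₁` in its simplest instance ("the first inequality follows since
`‖f‖ = sup_φ |⟨f, φ⟩| ≤ 𝔼|f(x)| = ‖f‖₁`", §5): `‖F‖_{□,r} ≤ ε` gives `|𝔼 F| ≤ ε` (`r ≥ 1`).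
[cite: ConlonFoxZhao2014, Section 5] -/
theorem HasSmallCut.abs_expect_le_of_sum {e : Finset ι} (he : e.Nonempty) {F : G → ℝ} {ε : ℝ}
    (h : HasSmallCut e (fun x : ι → G => F (∑ i ∈ e, x i)) ε) : |𝔼 z : G, F z| ≤ ε := by
  rw [← expect_comp_sum_eq he F]
  exact h.abs_expect_le

end shear

/-! ### The linear forms condition for weighted hypergraphs (§6) -/

section lfc

variable {ι : Type*} [DecidableEq ι] [Fintype ι] {X : Type*} [Fintype X]

/-- **The `k`-linear forms condition for a weighted hypergraph, within `δ`** (§6, the display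
before Thm. 6.5, quantitative form). The weighted `(k-1)`-uniform `k`-partite hypergraph is
`ν = (ν_{-j})_{j}`, `ν j` being the weight of the edge missing the vertex class `j` (a function
of the full point not depending on the coordinate `j`); a vertex `ω ∈ {0,1}^{[k] ∖ {j}}` is the
finite set `{i : ω_i = 1} ∌ j` and `x^{(ω)}_{-j}` is `Literature.mixPt x⁽⁰⁾ x⁽¹⁾ ω`. The condition: for
every sub-collection `E` of the `k 2^{k-1}` factors `ν_{-j}(x^{(ω)}_{-j})`,
`|𝔼_{x⁽⁰⁾, x⁽¹⁾ ∈ X^k} ∏_{(j,ω) ∈ E} ν_{-j}(x^{(ω)}_{-j}) - 1| ≤ δ`.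
[cite: ConlonFoxZhao2014, Section 6 (before Theorem 6.5)] -/
def LFCWithin (ν : ι → (ι → X) → ℝ) (δ : ℝ) : Prop :=
  ∀ E : Finset (ι × Finset ι), (∀ p ∈ E, p.1 ∉ p.2) →
    |(𝔼 q : (ι → X) × (ι → X), ∏ p ∈ E, ν p.1 (Literature.NumberTheory.Sieve.mixPt q.1 q.2 p.2)) - 1| ≤ δ

/-- The constant weight `1` satisfies the linear forms condition exactly. [folklore] -/
theorem lfcWithin_one [Nonempty X] {δ : ℝ} (hδ : 0 ≤ δ) :
    LFCWithin (fun (_ : ι) (_ : ι → X) => (1 : ℝ)) δ := by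
  intro E _
  simpa using hδ

/-- Monotonicity in `δ`. [folklore] -/
theorem LFCWithin.mono {ν : ι → (ι → X) → ℝ} {δ δ' : ℝ} (h : LFCWithin ν δ) (hδ : δ ≤ δ') :
    LFCWithin ν δ' :=
  fun E hE => (h E hE).trans hδ

end lfc

/-! ### Named facts: Theorem 5.1 and Theorem 6.5 -/

/-- **Conlon–Fox–Zhao, Theorem 5.1 (dense model theorem, Zhao's cut-norm form).** For every
`ε > 0` there is `ε' > 0` such that: if `ν : ℤ_N → [0, ∞)` satisfies `‖ν - 1‖_{□,r} ≤ ε'`, then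
for every `f : ℤ_N → [0,∞)` with `f ≤ ν` there is `f̃ : ℤ_N → [0,1]` with `‖f - f̃‖_{□,r} ≤ ε`.
Here `‖F‖_{□,r}` (5.3) is the cut norm of `(x_i)_{i ∈ e} ↦ F(∑_{i ∈ e} x_i)`, `r = |e|`, for a
finite set `e` of coordinates of points `x : ι → ℤ_N` (coordinates outside `e` are dummy
variables: `HasSmallCut`); `r` is fixed in §5 of the source, so `ε'` may depend on it (the Remark
after Thm. 5.1 gives `ε' = exp(-ε^{-O(1)})` independent of `r` and `N`). Proved in §5 from
Lemma 5.2, the duality (5.4), the separating hyperplane theorem and the Weierstrass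
approximation theorem. Named fact. [cite: ConlonFoxZhao2014, Theorem 5.1] -/
def DenseModel : Prop :=
  ∀ (ι : Type) [Fintype ι] [DecidableEq ι] (e : Finset ι) (ε : ℝ), 0 < ε → ∃ ε' : ℝ, 0 < ε' ∧
    ∀ (N : ℕ) [NeZero N] (ν : ZMod N → ℝ), (∀ x, 0 ≤ ν x) →
      HasSmallCut e (fun x : ι → ZMod N => ν (∑ i ∈ e, x i) - 1) ε' →
      ∀ f : ZMod N → ℝ, (∀ x, 0 ≤ f x) → (∀ x, f x ≤ ν x) →
        ∃ g : ZMod N → ℝ, (∀ x, 0 ≤ g x) ∧ (∀ x, g x ≤ 1) ∧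
          HasSmallCut e (fun x : ι → ZMod N => f (∑ i ∈ e, x i) - g (∑ i ∈ e, x i)) ε

/-- **Conlon–Fox–Zhao, Theorem 6.5 (relative simplex counting lemma).** Let `ν, g, g̃` be weighted
`(k-1)`-uniform `k`-partite hypergraphs on `X_1 ∪ ⋯ ∪ X_k` (here all `X_i = X`, a finite set;
`ν j, g j, g̃ j` are the weights on the edge missing the class `j`, functions of the full point not
depending on the coordinate `j`). Assume that `ν` satisfies the `k`-linear forms condition,
`0 ≤ g ≤ ν` and `0 ≤ g̃ ≤ 1`. If `‖g_{-j} - g̃_{-j}‖_□ = o(1)` for all `j`, then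
`𝔼_{x ∈ X^k}[∏_j g(x_{-j}) - ∏_j g̃(x_{-j})] = o(1)`. Rendered in `ε`–`δ` form (see the module
docstring): for all `k` and `ε > 0` there is `δ > 0` such that linear forms within `δ` and cut
norms at most `δ` force the difference of the simplex densities to be at most `ε`. Proved in §6
for `k = 3` (Thm. 6.2, by densification) with the modifications for general `k` indicated
(full proof in Conlon–Fox–Zhao, GAFA 25 (2015)). Named fact.
[cite: ConlonFoxZhao2014, Theorem 6.5] -/
def RelativeCounting : Prop :=
  ∀ (k : ℕ) (ε : ℝ), 0 < ε → ∃ δ : ℝ, 0 < δ ∧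
    ∀ (X : Type) [Fintype X] [Nonempty X] (ν g g' : Fin k → (Fin k → X) → ℝ),
      (∀ j, DependsOn (ν j) ({j}ᶜ : Set (Fin k))) → (∀ j, DependsOn (g j) ({j}ᶜ : Set (Fin k))) →
      (∀ j, DependsOn (g' j) ({j}ᶜ : Set (Fin k))) →
      (∀ j x, 0 ≤ g j x) → (∀ j x, g j x ≤ ν j x) → (∀ j x, 0 ≤ g' j x) → (∀ j x, g' j x ≤ 1) →
      LFCWithin ν δ → (∀ j, HasSmallCut (univ.erase j) (fun x => g j x - g' j x) δ) →
      |𝔼 x : Fin k → X, (∏ j, g j x - ∏ j, g' j x)| ≤ ε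

end Literature.Combinatorics.Additive.CFZ
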